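import Mathlib.NumberTheory.Height.NumberField
import Mathlib.FieldTheory.IntermediateField.Basic
import Mathlib.Analysis.Complex.Basic
import Mathlib.RingTheory.IntegralClosure.IsIntegral.Basic
import Mathlib.RingTheory.Localization.Integral
import HarnessLib

/-!
# The absolute logarithmic Weil height of a tuple of algebraic numbers in a number field `K̃ ⊂ ℂ`

Topic `Literature/NumberTheory/Transcendental`.  Vocabulary file (definitions with bodies and
proved API lemmas; no named facts, nothing asserted) for the arithmetic side of Roy–Waldschmidt,
*Approximation diophantienne et indépendance algébrique de logarithmes*, Ann. Sci. ÉNS (4) 30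
(1997) 753–796, §2 p. 761:

"On utilise aussi la notion de hauteur logarithmique absolue de Weil sur `𝐏ⁿ(ℚ̄)` définie, pour un
point `(x₀ : x₁ : ⋯ : x_n)` à coordonnées `x₀, …, x_n` dans un corps de nombres `K̃`, par
`h(x₀ : x₁ : ⋯ : x_n) = [K̃ : ℚ]⁻¹ ∑_v [K̃_v : ℚ_v] log max{|x₀|_v, |x₁|_v, …, |x_n|_v}`
où la somme est étendue aux places `v` du corps `K̃` et où chaque valeur absolue `| |_v` est
normalisée de telle sorte qu'elle étende la valeur absolue usuelle de `ℚ` si `v` est archimédienne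
et qu'elle vérifie `|p|_v = 1/p` si `v` est ultramétrique et si `p` est le nombre premier qui
appartient à son idéal de valuation.  En fait, on n'aura besoin que de la version affine de cette
hauteur sur `ℚ̄ⁿ` qu'on notera `h₁` et qui est donnée par `h₁(x₁, …, x_n) = h(1 : x₁ : ⋯ : x_n)`."

## The rendering

For a subfield `F ⊂ ℂ` finite over `ℚ` (a number field, `numberField_of_intermediateField`) and
a tuple `x : ι → ℂ` of elements of `F`, `weilHeight F x = [F:ℚ]⁻¹ · Height.logHeight (x : ι → F)`
(Mathlib's logarithmic height on the number field `F`: `∑_{v | ∞} [F_v:ℝ] log maxᵢ |xᵢ|_v +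
∑_{v ∤ ∞} log maxᵢ ‖xᵢ‖_v` with `‖·‖_v = N(𝔭_v)^{-ord_v}`, which is `[F:ℚ]` times the printed `h`:
`[F_v:ℚ_p] log |x|_v = log ‖x‖_v`), and `weilHeight₁ F x = weilHeight F (1, x)`.  Junk value `0` if
`F/ℚ` is infinite or some `xᵢ ∉ F`.  Proved API: the affine height of a single element is
`logHeight₁/[F:ℚ]`; monotonicity under passing to sub-tuples; `h₁(∏ xₘ^{sₘ}) ≤ ∑ sₘ h₁(xₘ)`;
**`h₁((∑ₘ c_{s,m} xₘ)ₛ) ≤ log S + h₁((xₘ)ₘ)`** for natural coefficients with `∑ₘ c_{s,m} ≤ S`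
(place by place: `≤ S · max` at the archimedean places, `≤ max` at the finite ones); and the crude
bound `h₁(z) ≤ log max{m, m·⌈z⌉}`-type estimate for a fixed algebraic `z` with `m z` integral,
uniform in the number field `F ∋ z` (`exists_weilHeight₁_le_of_isAlgebraic`).

## References

* [RoyWaldschmidt1997ENS] D. Roy, M. Waldschmidt, Ann. Sci. ÉNS (4) 30 (1997) 753–796, §2 p. 761;
  §5 p. 782 (the height estimates these lemmas serve).
* E. Bombieri, W. Gubler, *Heights in Diophantine Geometry*, CUP 2006, §1.5 (1.5.14–1.5.18).
-/

noncomputable section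

open Module NumberField Height

namespace Literature.NumberTheory.Transcendental

/-! ### Number fields inside `ℂ` -/

/-- A finite-dimensional subfield of `ℂ` (over `ℚ`) is a number field. [folklore] -/
theorem numberField_of_intermediateField (F : IntermediateField ℚ ℂ) [FiniteDimensional ℚ F] :
    NumberField F :=
  { to_charZero := inferInstance
    to_finiteDimensional := inferInstance }

/-! ### The definitions -/

/-- **The (projective) absolute logarithmic Weil height** `h(x) = [F:ℚ]⁻¹ ∑_v [F_v:ℚ_v] log maxᵢ |xᵢ|_v`
of a tuple `x` of complex numbers lying in the number field `F ⊂ ℂ` (computed in `F` through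
Mathlib's `Height.logHeight`; junk value `0` if `F/ℚ` is infinite or some `xᵢ ∉ F`).
[cite: RoyWaldschmidt1997ENS, §2, p. 761] -/
def weilHeight (F : IntermediateField ℚ ℂ) {ι : Type*} [Finite ι] (x : ι → ℂ) : ℝ :=
  open scoped Classical in
  if h : FiniteDimensional ℚ F ∧ ∀ i, x i ∈ F then
    haveI : FiniteDimensional ℚ F := h.1
    haveI : NumberField F := numberField_of_intermediateField F
    Height.logHeight (fun i => (⟨x i, h.2 i⟩ : F)) / Module.finrank ℚ F
  else 0

/-- **The affine absolute logarithmic Weil height** `h₁(x₁, …, x_n) = h(1 : x₁ : ⋯ : x_n)` of a tuple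
of elements of the number field `F ⊂ ℂ`. [cite: RoyWaldschmidt1997ENS, §2, p. 761] -/
def weilHeight₁ (F : IntermediateField ℚ ℂ) {ι : Type*} [Finite ι] (x : ι → ℂ) : ℝ :=
  weilHeight F (fun o : Option ι => o.elim (1 : ℂ) x)

variable (F : IntermediateField ℚ ℂ)

/-- Unfolding `weilHeight` on a tuple of elements of a number field `F ⊂ ℂ`. [folklore] -/
theorem weilHeight_eq [FiniteDimensional ℚ F] {ι : Type*} [Finite ι] (x : ι → ℂ) (hx : ∀ i, x i ∈ F) :
    weilHeight F x = (haveI : NumberField F := numberField_of_intermediateField F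
      Height.logHeight (fun i => (⟨x i, hx i⟩ : F))) / Module.finrank ℚ F := by
  classical
  rw [weilHeight, dif_pos ⟨‹_›, hx⟩]

/-- `weilHeight₁ x = weilHeight (1, x)`. [folklore] -/
theorem weilHeight₁_def {ι : Type*} [Finite ι] (x : ι → ℂ) :
    weilHeight₁ F x = weilHeight F (fun o : Option ι => o.elim (1 : ℂ) x) := rfl

/-- The tuple `(1, x)` in `F`. [folklore] -/
theorem optionElim_mem {ι : Type*} (x : ι → ℂ) (hx : ∀ i, x i ∈ F) (o : Option ι) :
    o.elim (1 : ℂ) x ∈ F := by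
  cases o with
  | none => exact one_mem F
  | some i => exact hx i

/-- Unfolding `weilHeight₁`: `[F:ℚ]⁻¹ logHeight (1, x)` computed in `F`. [folklore] -/
theorem weilHeight₁_eq [FiniteDimensional ℚ F] {ι : Type*} [Finite ι] (x : ι → ℂ) (hx : ∀ i, x i ∈ F) :
    weilHeight₁ F x = (haveI : NumberField F := numberField_of_intermediateField F
      Height.logHeight (fun o : Option ι => (⟨o.elim (1 : ℂ) x, optionElim_mem F x hx o⟩ : F))) /
        Module.finrank ℚ F := by
  rw [weilHeight₁_def, weilHeight_eq F _ (optionElim_mem F x hx)]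

/-- The `F`-tuple underlying `(1, x)` is `Option.elim · 1 (x as an F-tuple)`. [folklore] -/
theorem optionElim_coe_eq {ι : Type*} (x : ι → ℂ) (hx : ∀ i, x i ∈ F) :
    (fun o : Option ι => (⟨o.elim (1 : ℂ) x, optionElim_mem F x hx o⟩ : F)) =
      fun o : Option ι => o.elim (1 : F) (fun i => (⟨x i, hx i⟩ : F)) := by
  funext o; cases o <;> rfl

/-- The height is `≥ 0`. [folklore] -/
theorem weilHeight_nonneg {ι : Type*} [Finite ι] (x : ι → ℂ) : 0 ≤ weilHeight F x := by
  classical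
  rw [weilHeight]
  split_ifs with h
  · haveI : FiniteDimensional ℚ F := h.1
    haveI : NumberField F := numberField_of_intermediateField F
    exact div_nonneg (Height.logHeight_nonneg _) (Nat.cast_nonneg _)
  · exact le_rfl

/-- The affine height is `≥ 0`. [folklore] -/
theorem weilHeight₁_nonneg {ι : Type*} [Finite ι] (x : ι → ℂ) : 0 ≤ weilHeight₁ F x :=
  weilHeight_nonneg F _

/-! ### The affine height of one element -/

/-- An index equivalence `Option Unit ≃ Fin 2` sending `none ↦ 1`, `some () ↦ 0`. [folklore] -/
def optionUnitEquivFinTwo : Option Unit ≃ Fin 2 where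
  toFun o := o.elim 1 (fun _ => 0)
  invFun i := if i = 0 then some () else none
  left_inv o := by cases o <;> simp
  right_inv i := by fin_cases i <;> simp

/-- **`h₁(x) = [F:ℚ]⁻¹ · logHeight₁ x`** for a single element `x ∈ F`. [folklore] -/
theorem weilHeight₁_single_eq [FiniteDimensional ℚ F] {x : ℂ} (hx : x ∈ F) :
    weilHeight₁ F (fun _ : Unit => x) = (haveI : NumberField F := numberField_of_intermediateField F
      Height.logHeight₁ (⟨x, hx⟩ : F)) / Module.finrank ℚ F := by
  haveI : NumberField F := numberField_of_intermediateField F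
  rw [weilHeight₁_eq F (fun _ : Unit => x) (fun _ => hx), optionElim_coe_eq F (fun _ : Unit => x) (fun _ => hx),
    Height.logHeight₁_eq_logHeight]
  congr 1
  have e : (fun o : Option Unit => o.elim (1 : F) (fun _ => (⟨x, hx⟩ : F))) =
      ![(⟨x, hx⟩ : F), 1] ∘ optionUnitEquivFinTwo := by
    funext o; cases o <;> simp [optionUnitEquivFinTwo]
  rw [e, Height.logHeight_comp_equiv]

/-- `h₁` of `1` (or of the empty tuple) is `0`. [folklore] -/
theorem weilHeight₁_one [FiniteDimensional ℚ F] : weilHeight₁ F (fun _ : Unit => (1 : ℂ)) = 0 := by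
  haveI : NumberField F := numberField_of_intermediateField F
  rw [weilHeight₁_single_eq F (one_mem F)]
  have : (⟨(1 : ℂ), one_mem F⟩ : F) = 1 := rfl
  rw [this, Height.logHeight₁_one, zero_div]

/-- **`h₁(xy) ≤ h₁(x) + h₁(y)`.** [folklore] -/
theorem weilHeight₁_mul_le [FiniteDimensional ℚ F] {x y : ℂ} (hx : x ∈ F) (hy : y ∈ F) :
    weilHeight₁ F (fun _ : Unit => x * y) ≤ weilHeight₁ F (fun _ : Unit => x) + weilHeight₁ F (fun _ : Unit => y) := by
  haveI : NumberField F := numberField_of_intermediateField F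
  rw [weilHeight₁_single_eq F (mul_mem hx hy), weilHeight₁_single_eq F hx, weilHeight₁_single_eq F hy,
    ← add_div]
  apply div_le_div_of_nonneg_right _ (Nat.cast_nonneg _)
  have e : (⟨x * y, mul_mem hx hy⟩ : F) = (⟨x, hx⟩ : F) * ⟨y, hy⟩ := rfl
  rw [e]
  exact Height.logHeight₁_mul_le _ _

/-- **`h₁(xⁿ) = n h₁(x)`.** [folklore] -/
theorem weilHeight₁_pow [FiniteDimensional ℚ F] {x : ℂ} (hx : x ∈ F) (n : ℕ) :
    weilHeight₁ F (fun _ : Unit => x ^ n) = n * weilHeight₁ F (fun _ : Unit => x) := by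
  haveI : NumberField F := numberField_of_intermediateField F
  rw [weilHeight₁_single_eq F (pow_mem hx n), weilHeight₁_single_eq F hx, mul_div_assoc']
  congr 1
  have e : (⟨x ^ n, pow_mem hx n⟩ : F) = (⟨x, hx⟩ : F) ^ n := rfl
  rw [e, Height.logHeight₁_pow]

/-- **`h₁(∏ₘ xₘ^{sₘ}) ≤ ∑ₘ sₘ h₁(xₘ)`.** [folklore] -/
theorem weilHeight₁_prod_pow_le [FiniteDimensional ℚ F] {μ : Type*} [Fintype μ] (x : μ → ℂ)
    (hx : ∀ m, x m ∈ F) (s : μ → ℕ) :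
    weilHeight₁ F (fun _ : Unit => ∏ m, x m ^ s m) ≤ ∑ m, (s m : ℝ) * weilHeight₁ F (fun _ : Unit => x m) := by
  haveI : NumberField F := numberField_of_intermediateField F
  have hmem : (∏ m, x m ^ s m) ∈ F := prod_mem fun m _ => pow_mem (hx m) _
  rw [weilHeight₁_single_eq F hmem]
  have e : (⟨∏ m, x m ^ s m, hmem⟩ : F) = ∏ m, (⟨x m, hx m⟩ : F) ^ s m := by
    apply Subtype.ext
    simp only [IntermediateField.coe_prod]
    rfl
  rw [e]
  have h1 := Height.logHeight₁_prod_le Finset.univ (fun m => (⟨x m, hx m⟩ : F) ^ s m)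
  have h2 : ∑ m, Height.logHeight₁ ((⟨x m, hx m⟩ : F) ^ s m) = ∑ m, (s m : ℝ) * Height.logHeight₁ (⟨x m, hx m⟩ : F) := by
    refine Finset.sum_congr rfl fun m _ => ?_
    rw [Height.logHeight₁_pow]
  rw [h2] at h1
  calc Height.logHeight₁ (∏ m, (⟨x m, hx m⟩ : F) ^ s m) / Module.finrank ℚ F
      ≤ (∑ m, (s m : ℝ) * Height.logHeight₁ (⟨x m, hx m⟩ : F)) / Module.finrank ℚ F :=
        div_le_div_of_nonneg_right h1 (Nat.cast_nonneg _)
    _ = ∑ m, (s m : ℝ) * weilHeight₁ F (fun _ : Unit => x m) := by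
        rw [Finset.sum_div]
        refine Finset.sum_congr rfl fun m _ => ?_
        rw [weilHeight₁_single_eq F (hx m), mul_div_assoc]

/-! ### Sub-tuples -/

/-- **The height of a sub-tuple** (re-indexing along any map `f`): `h₁(x ∘ f) ≤ h₁(x)`. [folklore] -/
theorem weilHeight₁_comp_le [FiniteDimensional ℚ F] {ι ι' : Type*} [Finite ι] [Finite ι'] (f : ι → ι')
    (x : ι' → ℂ) (hx : ∀ i, x i ∈ F) : weilHeight₁ F (x ∘ f) ≤ weilHeight₁ F x := by
  haveI : NumberField F := numberField_of_intermediateField F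
  rw [show x ∘ f = fun i => x (f i) from rfl, weilHeight₁_eq F (fun i => x (f i)) (fun i => hx (f i)),
    weilHeight₁_eq F _ hx]
  apply div_le_div_of_nonneg_right _ (Nat.cast_nonneg _)
  have e : (fun o : Option ι => (⟨o.elim (1 : ℂ) (fun i => x (f i)), optionElim_mem F (fun i => x (f i)) (fun i => hx (f i)) o⟩ : F)) =
      (fun o : Option ι' => (⟨o.elim (1 : ℂ) x, optionElim_mem F x hx o⟩ : F)) ∘ Option.map f := by
    funext o; cases o <;> rfl
  rw [e]
  exact Height.logHeight_comp_le _ _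

/-- The affine height of one coordinate is at most that of the tuple. [folklore] -/
theorem weilHeight₁_single_le [FiniteDimensional ℚ F] {ι : Type*} [Finite ι] (x : ι → ℂ)
    (hx : ∀ i, x i ∈ F) (i : ι) : weilHeight₁ F (fun _ : Unit => x i) ≤ weilHeight₁ F x := by
  have := weilHeight₁_comp_le F (fun _ : Unit => i) x hx
  exact this

/-! ### Local-to-global comparison of heights of `(1, y)` and `(1, x)` in a number field -/

section numberField

variable {E : Type*} [Field E] [NumberField E]

/-- The finite product in the height of a tuple `(1, y)` has finite multiplicative support.
[folklore] -/
theorem hasFiniteMulSupport_iSup_optionElim {σ : Type*} [Finite σ] (y : σ → E) :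
    Function.HasFiniteMulSupport fun w : FinitePlace E => ⨆ o : Option σ, w (o.elim (1 : E) y) := by
  classical
  -- the support is contained in the union of the supports of `w ↦ max (w (y s)) 1`
  have hsub : (Function.mulSupport fun w : FinitePlace E => ⨆ o : Option σ, w (o.elim (1 : E) y)) ⊆
      ⋃ s : σ, Function.mulSupport fun w : FinitePlace E => max (w (y s)) 1 := by
    intro w hw
    rw [Function.mem_mulSupport] at hw
    simp only [Set.mem_iUnion, Function.mem_mulSupport]
    by_contra hall
    push Not at hall
    apply hw
    refine le_antisymm (ciSup_le fun o => ?_) ?_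
    · cases o with
      | none => simp
      | some s =>
        have := hall s
        have h1 : w (y s) ≤ max (w (y s)) 1 := le_max_left _ _
        rw [this] at h1
        exact h1
    · have := Finite.le_ciSup (fun o : Option σ => w (o.elim (1 : E) y)) none
      simpa using this
  refine Set.Finite.subset (Set.finite_iUnion fun s => ?_) hsub
  rcases eq_or_ne (y s) 0 with h0 | h0
  · have : (Function.mulSupport fun w : FinitePlace E => max (w (y s)) 1) = ∅ := by
      ext w; simp [h0]
    rw [this]; exact Set.finite_empty
  · refine Set.Finite.subset (FinitePlace.hasFiniteMulSupport h0) ?_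
    intro w hw
    rw [Function.mem_mulSupport] at hw ⊢
    intro h1
    apply hw
    rw [h1, max_self]

omit [NumberField E] in
/-- `1 ≤ maxₒ v((1, x)ₒ)` for any absolute value. [folklore] -/
theorem one_le_iSup_optionElim {ι : Type*} [Finite ι] (v : AbsoluteValue E ℝ) (x : ι → E) :
    1 ≤ ⨆ o : Option ι, v (o.elim (1 : E) x) := by
  have := Finite.le_ciSup (fun o : Option ι => v (o.elim (1 : E) x)) none
  simpa using this

omit [NumberField E] in
/-- `v(x_i) ≤ maxₒ v((1, x)ₒ)`. [folklore] -/
theorem apply_le_iSup_optionElim {ι : Type*} [Finite ι] (v : AbsoluteValue E ℝ) (x : ι → E) (i : ι) :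
    v (x i) ≤ ⨆ o : Option ι, v (o.elim (1 : E) x) := by
  have := Finite.le_ciSup (fun o : Option ι => v (o.elim (1 : E) x)) (some i)
  simpa using this

/-- **Local-to-global comparison.** If at every infinite place `v` and every `s`,
`|y_s|_v ≤ C · max{1, |x_i|_v}` and at every finite place `‖y_s‖_w ≤ max{1, ‖x_i‖_w}`, then
`H(1, y) ≤ C^{[E:ℚ]} H(1, x)` (`C ≥ 1`). [folklore] -/
theorem mulHeight_optionElim_le {ι σ : Type*} [Finite ι] [Finite σ] (x : ι → E) (y : σ → E) {C : ℝ}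
    (hC : 1 ≤ C)
    (harch : ∀ (v : InfinitePlace E) (s : σ), v.val (y s) ≤ C * ⨆ o : Option ι, v.val (o.elim (1 : E) x))
    (hfin : ∀ (w : FinitePlace E) (s : σ), w.val (y s) ≤ ⨆ o : Option ι, w.val (o.elim (1 : E) x)) :
    Height.mulHeight (fun o : Option σ => o.elim (1 : E) y) ≤
      C ^ Module.finrank ℚ E * Height.mulHeight (fun o : Option ι => o.elim (1 : E) x) := by
  classical
  have hX0 : (fun o : Option ι => o.elim (1 : E) x) ≠ 0 := fun h => by simpa using congrFun h none
  have hY0 : (fun o : Option σ => o.elim (1 : E) y) ≠ 0 := fun h => by simpa using congrFun h none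
  rw [NumberField.mulHeight_eq hY0, NumberField.mulHeight_eq hX0]
  simp only [InfinitePlace.coe_apply, FinitePlace.coe_apply]
  -- local bounds for the sups
  have hXnn : ∀ (v : AbsoluteValue E ℝ), 0 ≤ ⨆ o : Option ι, v (o.elim (1 : E) x) :=
    fun v => le_trans zero_le_one (one_le_iSup_optionElim v x)
  have hYnn : ∀ (v : AbsoluteValue E ℝ), 0 ≤ ⨆ o : Option σ, v (o.elim (1 : E) y) :=
    fun v => le_trans zero_le_one (one_le_iSup_optionElim v y)
  have hA : ∀ v : InfinitePlace E, (⨆ o : Option σ, v.val (o.elim (1 : E) y)) ≤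
      C * ⨆ o : Option ι, v.val (o.elim (1 : E) x) := by
    intro v
    refine ciSup_le fun o => ?_
    cases o with
    | none =>
      have h1 := one_le_iSup_optionElim v.val x
      have : v.val ((none : Option σ).elim (1 : E) y) = 1 := by simp
      rw [this]
      nlinarith
    | some s => simpa using harch v s
  have hB : ∀ w : FinitePlace E, (⨆ o : Option σ, w.val (o.elim (1 : E) y)) ≤
      ⨆ o : Option ι, w.val (o.elim (1 : E) x) := by
    intro w
    refine ciSup_le fun o => ?_
    cases o with
    | none =>
      have h1 := one_le_iSup_optionElim w.val x
      have : w.val ((none : Option σ).elim (1 : E) y) = 1 := by simp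
      rw [this]; exact h1
    | some s => simpa using hfin w s
  -- infinite part
  have hinf : ∏ v : InfinitePlace E, (⨆ o : Option σ, v.val (o.elim (1 : E) y)) ^ v.mult ≤
      C ^ Module.finrank ℚ E * ∏ v : InfinitePlace E, (⨆ o : Option ι, v.val (o.elim (1 : E) x)) ^ v.mult := by
    calc ∏ v : InfinitePlace E, (⨆ o : Option σ, v.val (o.elim (1 : E) y)) ^ v.mult
        ≤ ∏ v : InfinitePlace E, (C * ⨆ o : Option ι, v.val (o.elim (1 : E) x)) ^ v.mult := by
          apply Finset.prod_le_prod
          · intro v _; exact pow_nonneg (hYnn v.val) _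
          · intro v _; exact pow_le_pow_left₀ (hYnn v.val) (hA v) _
      _ = (∏ v : InfinitePlace E, C ^ v.mult) *
            ∏ v : InfinitePlace E, (⨆ o : Option ι, v.val (o.elim (1 : E) x)) ^ v.mult := by
          rw [← Finset.prod_mul_distrib]
          refine Finset.prod_congr rfl fun v _ => ?_
          rw [mul_pow]
      _ = C ^ Module.finrank ℚ E * ∏ v : InfinitePlace E, (⨆ o : Option ι, v.val (o.elim (1 : E) x)) ^ v.mult := by
          rw [Finset.prod_pow_eq_pow_sum, InfinitePlace.sum_mult_eq]
  -- finite part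
  have hfinprod : ∏ᶠ w : FinitePlace E, (⨆ o : Option σ, w.val (o.elim (1 : E) y)) ≤
      ∏ᶠ w : FinitePlace E, (⨆ o : Option ι, w.val (o.elim (1 : E) x)) := by
    refine finprod_le_finprod ?_ (fun w => hYnn w.val) ?_ (fun w => hB w)
    · exact hasFiniteMulSupport_iSup_optionElim y
    · exact hasFiniteMulSupport_iSup_optionElim x
  have hfinnn : 0 ≤ ∏ᶠ w : FinitePlace E, (⨆ o : Option σ, w.val (o.elim (1 : E) y)) :=
    finprod_nonneg fun w => hYnn w.val
  have hinfnn : 0 ≤ ∏ v : InfinitePlace E, (⨆ o : Option ι, v.val (o.elim (1 : E) x)) ^ v.mult :=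
    Finset.prod_nonneg fun v _ => pow_nonneg (hXnn v.val) _
  calc (∏ v : InfinitePlace E, (⨆ o : Option σ, v.val (o.elim (1 : E) y)) ^ v.mult) *
        ∏ᶠ w : FinitePlace E, (⨆ o : Option σ, w.val (o.elim (1 : E) y))
      ≤ (C ^ Module.finrank ℚ E * ∏ v : InfinitePlace E, (⨆ o : Option ι, v.val (o.elim (1 : E) x)) ^ v.mult) *
          ∏ᶠ w : FinitePlace E, (⨆ o : Option ι, w.val (o.elim (1 : E) x)) :=
        mul_le_mul hinf hfinprod hfinnn (mul_nonneg (pow_nonneg (by linarith) _) hinfnn)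
    _ = C ^ Module.finrank ℚ E * ((∏ v : InfinitePlace E, (⨆ o : Option ι, v.val (o.elim (1 : E) x)) ^ v.mult) *
          ∏ᶠ w : FinitePlace E, (⨆ o : Option ι, w.val (o.elim (1 : E) x))) := by ring

/-- **Heights of tuples of integer linear combinations** (local-to-global): for natural
coefficients with `∑ₘ c_{s,m} ≤ S` (`S ≥ 1`),
`H(1, (∑ₘ c_{s,m} xₘ)ₛ) ≤ S^{[E:ℚ]} · H(1, (xₘ)ₘ)`. [folklore] -/
theorem mulHeight_linearComb_le {μ σ : Type*} [Fintype μ] [Finite σ] (x : μ → E) (c : σ → μ → ℕ)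
    {S : ℕ} (hS1 : 1 ≤ S) (hS : ∀ s, ∑ m, c s m ≤ S) :
    Height.mulHeight (fun o : Option σ => o.elim (1 : E) (fun s => ∑ m, (c s m : E) * x m)) ≤
      (S : ℝ) ^ Module.finrank ℚ E * Height.mulHeight (fun o : Option μ => o.elim (1 : E) x) := by
  classical
  have hSR : (1 : ℝ) ≤ S := by exact_mod_cast hS1
  refine mulHeight_optionElim_le x _ hSR (fun v s => ?_) (fun w s => ?_)
  · -- archimedean: `|∑ c x| ≤ ∑ c |x| ≤ (∑ c) max ≤ S max`
    have hmax : ∀ m, v.val (x m) ≤ ⨆ o : Option μ, v.val (o.elim (1 : E) x) :=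
      fun m => apply_le_iSup_optionElim v.val x m
    have hM0 : 0 ≤ ⨆ o : Option μ, v.val (o.elim (1 : E) x) :=
      le_trans zero_le_one (one_le_iSup_optionElim v.val x)
    calc v.val (∑ m, (c s m : E) * x m) ≤ ∑ m, v.val ((c s m : E) * x m) := v.val.sum_le _ _
      _ = ∑ m, (c s m : ℝ) * v.val (x m) := by
            refine Finset.sum_congr rfl fun m _ => ?_
            rw [map_mul]
            congr 1
            exact InfinitePlace.map_natCast v (c s m)
      _ ≤ ∑ m, (c s m : ℝ) * ⨆ o : Option μ, v.val (o.elim (1 : E) x) :=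
            Finset.sum_le_sum fun m _ => mul_le_mul_of_nonneg_left (hmax m) (Nat.cast_nonneg _)
      _ = (∑ m, (c s m : ℝ)) * ⨆ o : Option μ, v.val (o.elim (1 : E) x) := by rw [Finset.sum_mul]
      _ ≤ S * ⨆ o : Option μ, v.val (o.elim (1 : E) x) := by
            apply mul_le_mul_of_nonneg_right _ hM0
            exact_mod_cast hS s
  · -- finite: `‖∑ c x‖ ≤ max ‖c x‖ ≤ max ‖x‖`
    have hna : IsNonarchimedean (w.val : E → ℝ) := fun a b => FinitePlace.add_le w a b
    have hmax : ∀ m, w.val (x m) ≤ ⨆ o : Option μ, w.val (o.elim (1 : E) x) :=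
      fun m => apply_le_iSup_optionElim w.val x m
    have h0 : (0 : ℝ) ≤ ⨆ o : Option μ, w.val (o.elim (1 : E) x) :=
      le_trans zero_le_one (one_le_iSup_optionElim w.val x)
    rcases (Finset.univ : Finset μ).eq_empty_or_nonempty with hμ | hμ
    · simp only [hμ, Finset.sum_empty, map_zero]; exact h0
    · calc w.val (∑ m, (c s m : E) * x m) ≤ Finset.univ.sup' hμ fun m => w.val ((c s m : E) * x m) :=
              hna.apply_sum_le_sup hμ
        _ ≤ ⨆ o : Option μ, w.val (o.elim (1 : E) x) := by
              refine Finset.sup'_le hμ _ fun m _ => ?_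
              exact le_trans hna.nmul_le (hmax m)

end numberField

/-! ### The bound for linear combinations, for `weilHeight₁` -/

/-- **`h₁((∑ₘ c_{s,m} xₘ)ₛ) ≤ log S + h₁((xₘ)ₘ)`** for natural coefficients with
`∑ₘ c_{s,m} ≤ S`, `S ≥ 1` — the estimate
"`h₁(γ̃₁^{(i)}, …, γ̃_N^{(i)}) ≤ log(S₁ + ⋯ + S_{ℓ₁}) + h₁(γ̃₁^{(i)}, …, γ̃_{ℓ₁}^{(i)})`" of p. 782.
[cite: RoyWaldschmidt1997ENS, §5, p. 782] -/
theorem weilHeight₁_linearComb_le [FiniteDimensional ℚ F] {μ σ : Type*} [Fintype μ] [Finite σ]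
    (x : μ → ℂ) (hx : ∀ m, x m ∈ F) (c : σ → μ → ℕ) {S : ℕ} (hS1 : 1 ≤ S) (hS : ∀ s, ∑ m, c s m ≤ S) :
    weilHeight₁ F (fun s => ∑ m, (c s m : ℂ) * x m) ≤ Real.log S + weilHeight₁ F x := by
  haveI : NumberField F := numberField_of_intermediateField F
  have hmem : ∀ s, (∑ m, (c s m : ℂ) * x m) ∈ F :=
    fun s => sum_mem fun m _ => mul_mem (natCast_mem F _) (hx m)
  rw [weilHeight₁_eq F _ hmem, weilHeight₁_eq F _ hx, optionElim_coe_eq F _ hmem, optionElim_coe_eq F _ hx]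
  have e : (fun s => (⟨∑ m, (c s m : ℂ) * x m, hmem s⟩ : F)) = fun s => ∑ m, (c s m : F) * (⟨x m, hx m⟩ : F) := by
    funext s
    apply Subtype.ext
    simp only [IntermediateField.coe_sum]
    rfl
  rw [e]
  have hD : (0 : ℝ) < Module.finrank ℚ F := by exact_mod_cast Module.finrank_pos
  have key := mulHeight_linearComb_le (fun m => (⟨x m, hx m⟩ : F)) c hS1 hS
  have hlog := Real.log_le_log (Height.mulHeight_pos _) key
  rw [Real.log_mul (by positivity) (Height.mulHeight_pos _).ne', Real.log_pow] at hlog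
  rw [Height.logHeight_eq_log_mulHeight, Height.logHeight_eq_log_mulHeight, div_le_iff₀ hD]
  have : (Real.log S + Real.log (Height.mulHeight fun o : Option μ => o.elim (1 : F) fun m => (⟨x m, hx m⟩ : F)) /
      Module.finrank ℚ F) * Module.finrank ℚ F = Module.finrank ℚ F * Real.log S +
        Real.log (Height.mulHeight fun o : Option μ => o.elim (1 : F) fun m => (⟨x m, hx m⟩ : F)) := by
    field_simp
  rw [this]
  exact hlog

/-! ### A crude uniform bound for the height of a fixed algebraic number -/

section numberField2

variable {E : Type*} [Field E] [NumberField E]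

/-- A finite place takes values `≤ 1` on algebraic integers. [folklore] -/
theorem finitePlace_apply_le_one_of_isIntegral (w : FinitePlace E) {x : E} (hx : IsIntegral ℤ x) :
    w x ≤ 1 := by
  have hmem : x ∈ integralClosure ℤ E := (_root_.mem_integralClosure_iff ℤ E).mpr hx
  have h := FinitePlace.norm_le_one E (FinitePlace.maximalIdeal w) (⟨x, hmem⟩ : 𝓞 E)
  rw [RingOfIntegers.map_mk, FinitePlace.norm_embedding_eq] at h
  exact h

/-- **The height of `(1, z)` for `z` with `m z` an algebraic integer all of whose complex conjugates
have absolute value `≤ B`:** `H(1, z) ≤ (max |m| B)^{[E:ℚ]}` — through `H(1, z) = H(m, m z)`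
(product formula), `max{|m|_v, |m z|_v} ≤ max{|m|, B}` at the infinite places and `≤ 1` at the
finite ones. [folklore] -/
theorem mulHeight_one_le_of_isIntegral_smul {z : E} {m : ℤ} (hm : m ≠ 0) (hint : IsIntegral ℤ ((m : E) * z))
    {B : ℝ} (hB : ∀ φ : E →+* ℂ, ‖φ ((m : E) * z)‖ ≤ B) :
    Height.mulHeight (fun o : Option Unit => o.elim (1 : E) (fun _ => z)) ≤
      (max (|(m : ℝ)|) B) ^ Module.finrank ℚ E := by
  classical
  set X : Option Unit → E := fun o => o.elim (1 : E) (fun _ => z) with hX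
  have hmE : (m : E) ≠ 0 := by exact_mod_cast hm
  have hscale := Height.mulHeight_smul_eq_mulHeight X hmE
  rw [← hscale]
  set Y : Option Unit → E := (m : E) • X with hY
  have hYnone : Y none = (m : E) := by simp [hY, hX]
  have hYsome : Y (some ()) = (m : E) * z := by simp [hY, hX, smul_eq_mul]
  have hY0 : Y ≠ 0 := fun h => by
    have := congrFun h none
    rw [hYnone] at this
    exact hmE this
  rw [NumberField.mulHeight_eq hY0]
  -- bounds
  have hmR : (1 : ℝ) ≤ |(m : ℝ)| := by
    have : (1 : ℤ) ≤ |m| := Int.one_le_abs hm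
    have h' : ((1 : ℤ) : ℝ) ≤ ((|m| : ℤ) : ℝ) := by exact_mod_cast this
    simpa using h'
  set M₀ : ℝ := max (|(m : ℝ)|) B with hM₀
  have hM₀1 : 1 ≤ M₀ := le_trans hmR (le_max_left _ _)
  have hYnn : ∀ (v : AbsoluteValue E ℝ), 0 ≤ ⨆ o, v (Y o) := fun v => Real.iSup_nonneg fun o => v.nonneg _
  -- infinite places
  have hA : ∀ v : InfinitePlace E, (⨆ o, v (Y o)) ≤ M₀ := by
    intro v
    refine ciSup_le fun o => ?_
    cases o with
    | none =>
      rw [hYnone, ← InfinitePlace.norm_embedding_eq, map_intCast, Complex.norm_intCast]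
      exact le_max_left _ _
    | some u =>
      cases u
      rw [hYsome, ← InfinitePlace.norm_embedding_eq]
      exact le_trans (hB _) (le_max_right _ _)
  have hinf : ∏ v : InfinitePlace E, (⨆ o, v (Y o)) ^ v.mult ≤ M₀ ^ Module.finrank ℚ E := by
    calc ∏ v : InfinitePlace E, (⨆ o, v (Y o)) ^ v.mult ≤ ∏ v : InfinitePlace E, M₀ ^ v.mult := by
          apply Finset.prod_le_prod
          · intro v _; exact pow_nonneg (by simpa [InfinitePlace.coe_apply] using hYnn v.val) _
          · intro v _; exact pow_le_pow_left₀ (by simpa [InfinitePlace.coe_apply] using hYnn v.val) (hA v) _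
      _ = M₀ ^ Module.finrank ℚ E := by rw [Finset.prod_pow_eq_pow_sum, InfinitePlace.sum_mult_eq]
  -- finite places: all entries are algebraic integers
  have hintm : IsIntegral ℤ ((m : E)) := by
    have : IsIntegral ℤ (algebraMap ℤ E m) := isIntegral_algebraMap
    simpa using this
  have hB1 : ∀ w : FinitePlace E, (⨆ o, w (Y o)) ≤ 1 := by
    intro w
    refine ciSup_le fun o => ?_
    cases o with
    | none => rw [hYnone]; exact finitePlace_apply_le_one_of_isIntegral w hintm
    | some u => cases u; rw [hYsome]; exact finitePlace_apply_le_one_of_isIntegral w hint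
  have hsupp : Function.HasFiniteMulSupport fun w : FinitePlace E => ⨆ o, w (Y o) := by
    refine Set.Finite.subset (FinitePlace.hasFiniteMulSupport hmE) ?_
    intro w hw
    rw [Function.mem_mulSupport] at hw ⊢
    intro h1
    apply hw
    refine le_antisymm (hB1 w) ?_
    have := Finite.le_ciSup (fun o : Option Unit => w (Y o)) none
    rw [hYnone, h1] at this
    exact this
  have hfin : ∏ᶠ w : FinitePlace E, (⨆ o, w (Y o)) ≤ 1 := by
    have h := finprod_le_finprod hsupp (fun w => by simpa [FinitePlace.coe_apply] using hYnn w.val)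
      (Function.hasFiniteMulSupport_fun_one (M := ℝ) (α := FinitePlace E)) (fun w => hB1 w)
    simpa using h
  have hfinnn : 0 ≤ ∏ᶠ w : FinitePlace E, (⨆ o, w (Y o)) :=
    finprod_nonneg fun w => by simpa [FinitePlace.coe_apply] using hYnn w.val
  calc (∏ v : InfinitePlace E, (⨆ o, v (Y o)) ^ v.mult) * ∏ᶠ w : FinitePlace E, (⨆ o, w (Y o))
      ≤ M₀ ^ Module.finrank ℚ E * 1 := mul_le_mul hinf hfin hfinnn (pow_nonneg (by linarith) _)
    _ = M₀ ^ Module.finrank ℚ E := mul_one _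

end numberField2

/-- **A crude bound for the height of a fixed algebraic number, uniform in the number field.**  For
`z ∈ ℂ` algebraic over `ℚ` there is `C ≥ 0` with `h₁(z) ≤ C` whatever the number field `F ∋ z` in
which the (absolute) height is computed: with `m z` an algebraic integer (`m ∈ ℤ ∖ 0`) and `B` a
bound for the complex conjugates of `m z`, `C = log max{|m|, B}`.  (Used for the algebraic
coordinates `γ_j^{(d₀+i)} ∈ K ∩ ℚ̄`, whose heights must be bounded independently of the residue
field `K̃` of degree `D → ∞`.) [cite: RoyWaldschmidt1997ENS, §5, p. 782] -/
theorem exists_weilHeight₁_le_of_isAlgebraic {z : ℂ} (hz : IsAlgebraic ℚ z) :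
    ∃ C : ℝ, 0 ≤ C ∧ ∀ (F : IntermediateField ℚ ℂ) [FiniteDimensional ℚ F], z ∈ F →
      weilHeight₁ F (fun _ : Unit => z) ≤ C := by
  classical
  have hzZ : IsAlgebraic ℤ z := (IsFractionRing.isAlgebraic_iff ℤ ℚ ℂ).mpr hz
  obtain ⟨m, hm, hint⟩ := hzZ.exists_integral_multiple
  rw [zsmul_eq_mul] at hint
  set p : Polynomial ℤ := minpoly ℤ ((m : ℂ) * z) with hp
  set B : ℝ := (((p.map (Int.castRingHom ℂ)).roots.toFinset.sup fun r => ‖r‖₊ : NNReal) : ℝ) with hBdef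
  have hB0 : 0 ≤ B := NNReal.coe_nonneg _
  have hmR : (1 : ℝ) ≤ |(m : ℝ)| := by
    have : (1 : ℤ) ≤ |m| := Int.one_le_abs hm
    have h' : ((1 : ℤ) : ℝ) ≤ ((|m| : ℤ) : ℝ) := by exact_mod_cast this
    simpa using h'
  refine ⟨Real.log (max (|(m : ℝ)|) B), Real.log_nonneg (le_trans hmR (le_max_left _ _)), ?_⟩
  intro F _ hzF
  haveI : NumberField F := numberField_of_intermediateField F
  set z' : F := ⟨z, hzF⟩ with hz'
  -- the `ℤ`-algebra embedding `F → ℂ`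
  let f : F →ₐ[ℤ] ℂ := (algebraMap F ℂ).toIntAlgHom
  have hf : Function.Injective f := (algebraMap F ℂ).injective
  have hfy : f ((m : F) * z') = (m : ℂ) * z := by
    rw [map_mul, map_intCast]
    rfl
  have hint' : IsIntegral ℤ ((m : F) * z') := by
    rw [← isIntegral_algHom_iff f hf, hfy]; exact hint
  have hminpoly : minpoly ℤ ((m : F) * z') = p := by
    rw [hp, ← hfy]; exact (minpoly.algHom_eq f hf _).symm
  -- conjugates of `m z` are roots of `p`
  have hBφ : ∀ φ : F →+* ℂ, ‖φ ((m : F) * z')‖ ≤ B := by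
    intro φ
    have hroot : φ ((m : F) * z') ∈ (p.map (Int.castRingHom ℂ)).roots := by
      rw [Polynomial.mem_roots (Polynomial.map_monic_ne_zero (minpoly.monic hint)), Polynomial.IsRoot.def,
        Polynomial.eval_map]
      have h1 : Polynomial.aeval (φ ((m : F) * z')) (minpoly ℤ ((m : F) * z')) = 0 := by
        rw [show φ ((m : F) * z') = φ.toIntAlgHom ((m : F) * z') from rfl, Polynomial.aeval_algHom_apply,
          minpoly.aeval, map_zero]
      rw [hminpoly, Polynomial.aeval_def] at h1
      have e : algebraMap ℤ ℂ = Int.castRingHom ℂ := rfl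
      rw [e] at h1
      exact h1
    have hmem : φ ((m : F) * z') ∈ (p.map (Int.castRingHom ℂ)).roots.toFinset := Multiset.mem_toFinset.mpr hroot
    have := Finset.le_sup (f := fun r : ℂ => ‖r‖₊) hmem
    rw [hBdef]
    exact_mod_cast this
  have key := mulHeight_one_le_of_isIntegral_smul hm hint' hBφ
  -- conclude
  rw [weilHeight₁_eq F (fun _ : Unit => z) (fun _ => hzF), optionElim_coe_eq F (fun _ : Unit => z) (fun _ => hzF),
    Height.logHeight_eq_log_mulHeight]
  have hD : (0 : ℝ) < Module.finrank ℚ F := by exact_mod_cast Module.finrank_pos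
  rw [div_le_iff₀ hD]
  have hM1 : (1 : ℝ) ≤ max (|(m : ℝ)|) B := le_trans hmR (le_max_left _ _)
  have hlog := Real.log_le_log (Height.mulHeight_pos _) key
  rw [Real.log_pow] at hlog
  have e : (fun o : Option Unit => o.elim (1 : F) fun _ : Unit => (⟨z, hzF⟩ : F)) =
      fun o : Option Unit => o.elim (1 : F) fun _ : Unit => z' := rfl
  rw [e]
  linarith

end Literature.NumberTheory.Transcendental
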